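/-
Copyright: derived here (Resolution Observatory cell `pub-rosobs`, carver gen 57). AI-written Lean; AI review is weaker than expert
review.  Companion file of the cell's POLYNOMIAL weighted-centre model `W(f)`: the RESCALED substitutions `Φ_{λσ}` (`σ ↦ λσ`,
`λ` a scalar of weight `0`) of engine 1's LEMMA FC (B3) — they are again (graded) isotropies and their pure vectors are the rescaled
pure vectors `P(Φ_{λσ}) = P(Φ)(λσ)` (THEOREM-FC-eng1-g37 §1 (F2), §4 (B3), §7 (4)).
Instrument — NOT a resolution theorem and NOT a statement about the invariant of [AbramovichTemkinWlodarczyk2024].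
-/
import Literature.AlgebraicGeometry.Resolution.WeightedCentreGradedIsotropy
import Literature.AlgebraicGeometry.Resolution.WeightedCentrePureVectors
import Mathlib.Algebra.Polynomial.Eval.Degree
import HarnessLib

/-!
# Rescaled substitutions `Φ_{λσ}` and their pure vectors

Uniform value line: INSTRUMENT — kernel-checked bookkeeping for the polynomial weighted-centre model `W(f)` of the cell
(engine 1's toy model: THEOREM-FC-eng1-g37 §4 (B3)) — NOT a resolution theorem, NOT a statement about the
Abramovich–Temkin–Włodarczyk invariant, NOT summit progress; AI-written Lean, AI review is weaker than expert review.

Setting of `WeightedCentreIsotropyTwist` / `WeightedCentrePureVectors`: substitutions are ring endomorphisms `Φ` of `A₀[σ]`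
(`A₀ = k[ε] = MvPolynomial ι k` for pure vectors and gradings), `Φ σ = σ`, determined by the images `Φ(ε_i) = ε_i + A_i(σ, ε)`.

* `sigmaScale a : σ ↦ a σ`, the `A₀`-algebra endomorphism of `A₀[σ]` (`sigmaScale (−1) = sigmaNeg`); `coeff_sigmaScale`:
  the `σ^n`-coefficient gets multiplied by `a^n`; `≡ id (mod σ)`.
* `rescaleHom a Φ = Φ_{aσ}`: the ring endomorphism with `Φ_{aσ}(ε_i) = (σ ↦ aσ)(Φ ε_i) = ε_i + A_i(aσ, ε)` and `Φ_{aσ} σ = σ`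
  (`rescaleHom 1 Φ = Φ`, `rescaleHom (−1) Φ = twistConj Φ = Φ_{−σ}`); the intertwining `Φ_{aσ} ∘ (σ ↦ aσ) = (σ ↦ aσ) ∘ Φ` when
  `Φ` fixes `C a` (`rescaleHom_comp_sigmaScale`), hence `(Φ Ψ)_{aσ} = Φ_{aσ} Ψ_{aσ}` and `(id)_{aσ} = id` (so inverses rescale);
  `Φ_{aσ}` is an isotropy of every `g ∈ A₀` of which `Φ` is one (`isIsotropyOf_rescaleHom` — engine §1 (F2)), is `≡ id (mod σ)` if
  `Φ` is, and is GRADED of the same degree if `Φ` is and `a = C c` is a scalar (`isGradedHom_rescaleHom`; scalars have weight `0`).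
* **pure vectors** (`A₀ = k[ε]`, `a = C c`, `c ∈ k`): `pureVec (Φ_{cσ}) i = (σ ↦ cσ)(pureVec Φ i)`, i.e. coefficientwise
  `P(Φ_{cσ})_{i,n} = c^n · P(Φ)_{i,n}` (`coeff_pureVec_rescaleHom` — engine §7 (4) "P(Φ_{λτ}) = P(Φ)(λτ)"), and for three scalars
  `l = (l₀, l₁, l₂)`: `Σ_a P(Φ_{l_a σ})_{i,n} = (l₀^n + l₁^n + l₂^n) · P(Φ)_{i,n}` (`coeff_sum_pureVec_rescaleHom`) — with the cell's
  `(1, t(s), s)` over `R = k⟦s⟧` this is `u_n · P(Φ)_{i,n}`, which vanishes on the least pure class `n = j*` by `u_{j*} = 0`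
  (LEMMA FC (B2)/(B3); combine with the three-factor composite formula `IsGradedHom.pureVec_comp_comp` of
  `WeightedCentreGradedPureVectors`).

What is NOT here (engine 1's modelling): the base change `k → R = k⟦s⟧` of a given isotropy (the statements hold over any
commutative ring `k`, so they are applied with `k := R`), LEMMA PR″, the hypotheses (H1)/(H>)/(Hmax) and (B4) `Θ = id`.

Pattern cite for the `mod σ` calculus and substitution endomorphisms [cite: SerreLocalFields1979, Ch. II §4 Lemma 1]; for weighted
gradings [cite: AbramovichTemkinWlodarczyk2024, Thm. 5.3.1 (2)–(3) (p. 1578)].  Formalisation and statements ours, elementary.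
-/

namespace Literature.AlgebraicGeometry.Resolution.WeightedBlowup

open Polynomial

/-! ## `σ ↦ aσ` -/

section SigmaScale

variable {A₀ : Type*} [CommRing A₀]

/-- The `A₀`-algebra endomorphism `σ ↦ a σ` of `A₀[σ]` (construction, ours). [cite: SerreLocalFields1979, Ch. II §4 Lemma 1] -/
noncomputable def sigmaScale (a : A₀) : A₀[X] →ₐ[A₀] A₀[X] := aeval (C a * X)

/-- Unfolding: `(σ ↦ aσ) f = f ∘ (aσ)` (plumbing). [cite: SerreLocalFields1979, Ch. II §4 Lemma 1] -/
theorem sigmaScale_apply (a : A₀) (f : A₀[X]) : sigmaScale a f = f.comp (C a * X) := rfl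

/-- `(σ ↦ aσ) σ = aσ` (plumbing). [cite: SerreLocalFields1979, Ch. II §4 Lemma 1] -/
@[simp] theorem sigmaScale_X (a : A₀) : sigmaScale a (X : A₀[X]) = C a * X := by
  rw [sigmaScale_apply, X_comp]

/-- `σ ↦ aσ` fixes `A₀` (plumbing). [cite: SerreLocalFields1979, Ch. II §4 Lemma 1] -/
@[simp] theorem sigmaScale_C (a b : A₀) : sigmaScale a (C b) = C b := by
  rw [sigmaScale_apply, C_comp]

/-- `σ ↦ aσ` multiplies the `σ^n`-coefficient by `a^n` (bookkeeping). [cite: SerreLocalFields1979, Ch. II §4 Lemma 1] -/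
theorem coeff_sigmaScale (a : A₀) (f : A₀[X]) (n : ℕ) : (sigmaScale a f).coeff n = a ^ n * f.coeff n := by
  rw [sigmaScale_apply, comp_C_mul_X_coeff, mul_comm]

/-- `σ ↦ 1·σ` is the identity (plumbing). [cite: SerreLocalFields1979, Ch. II §4 Lemma 1] -/
theorem sigmaScale_one : sigmaScale (1 : A₀) = AlgHom.id A₀ A₀[X] :=
  Polynomial.algHom_ext (by rw [sigmaScale_X, C_1, one_mul, AlgHom.coe_id, id_eq])

/-- `σ ↦ (−1)σ` is the twist `sigmaNeg` (plumbing). [cite: SerreLocalFields1979, Ch. II §4 Lemma 1] -/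
theorem sigmaScale_neg_one : sigmaScale (-1 : A₀) = sigmaNeg :=
  Polynomial.algHom_ext (by rw [sigmaScale_X, sigmaNeg_X, C_neg, C_1, neg_one_mul])

/-- `σ ↦ aσ` maps the ideal `(σ)` into itself (bookkeeping). [cite: SerreLocalFields1979, Ch. II §4 Lemma 1] -/
theorem sigmaScale_mem_span_X (a : A₀) {f : A₀[X]} (hf : f ∈ Ideal.span {(X : A₀[X])}) :
    sigmaScale a f ∈ Ideal.span {(X : A₀[X])} := by
  obtain ⟨g, rfl⟩ := Ideal.mem_span_singleton'.mp hf
  rw [map_mul, sigmaScale_X, ← mul_assoc]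
  exact Ideal.mul_mem_left _ _ (Ideal.mem_span_singleton_self X)

/-- `σ ↦ aσ` is `≡ id (mod σ)` (bookkeeping). [cite: SerreLocalFields1979, Ch. II §4 Lemma 1] -/
theorem sigmaScale_sub_self_mem (a : A₀) (f : A₀[X]) : sigmaScale a f - f ∈ Ideal.span {(X : A₀[X])} := by
  refine sub_self_mem_of_forall_C (sigmaScale a).toRingHom _ ?_ (fun b => ?_) f
  · rw [AlgHom.toRingHom_eq_coe, RingHom.coe_coe, sigmaScale_X, ← sub_one_mul]
    exact Ideal.mul_mem_left _ _ (Ideal.mem_span_singleton_self X)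
  · rw [AlgHom.toRingHom_eq_coe, RingHom.coe_coe, sigmaScale_C, sub_self]
    exact zero_mem _

/-! ## `Φ_{aσ}` -/

/-- The **rescaled substitution** `Φ_{aσ}`: `Φ_{aσ}(C f) = (σ ↦ aσ)(Φ (C f))`, `Φ_{aσ}(σ) = σ` (construction, ours; engine:
`A_i(σ, ε) ↦ A_i(aσ, ε)`). [cite: SerreLocalFields1979, Ch. II §4 Lemma 1] -/
noncomputable def rescaleHom (a : A₀) (Φ : A₀[X] →+* A₀[X]) : A₀[X] →+* A₀[X] :=
  eval₂RingHom ((sigmaScale a).toRingHom.comp (Φ.comp C)) X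

/-- `Φ_{aσ}` on `A₀` (plumbing). [cite: SerreLocalFields1979, Ch. II §4 Lemma 1] -/
theorem rescaleHom_C (a : A₀) (Φ : A₀[X] →+* A₀[X]) (f : A₀) : rescaleHom a Φ (C f) = sigmaScale a (Φ (C f)) := by
  rw [rescaleHom, coe_eval₂RingHom, eval₂_C]
  rfl

/-- `Φ_{aσ} σ = σ` (plumbing). [cite: SerreLocalFields1979, Ch. II §4 Lemma 1] -/
@[simp] theorem rescaleHom_X (a : A₀) (Φ : A₀[X] →+* A₀[X]) : rescaleHom a Φ X = X := by
  rw [rescaleHom, coe_eval₂RingHom, eval₂_X]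

/-- `Φ_{1·σ} = Φ` (for `Φ σ = σ`) (plumbing). [cite: SerreLocalFields1979, Ch. II §4 Lemma 1] -/
theorem rescaleHom_one (Φ : A₀[X] →+* A₀[X]) (hX : Φ X = X) : rescaleHom 1 Φ = Φ :=
  Polynomial.ringHom_ext (fun b => by rw [rescaleHom_C, sigmaScale_one, AlgHom.coe_id, id_eq]) (by rw [rescaleHom_X, hX])

/-- `Φ_{(−1)σ} = Φ_{−σ} = twistConj Φ` (for `Φ σ = σ`) (plumbing). [cite: SerreLocalFields1979, Ch. II §4 Lemma 1] -/
theorem rescaleHom_neg_one (Φ : A₀[X] →+* A₀[X]) (hX : Φ X = X) : rescaleHom (-1) Φ = twistConj Φ :=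
  Polynomial.ringHom_ext (fun b => by rw [rescaleHom_C, sigmaScale_neg_one, twistConj_C]) (by rw [rescaleHom_X, twistConj_X Φ hX])

/-- `(id)_{aσ} = id` (plumbing). [cite: SerreLocalFields1979, Ch. II §4 Lemma 1] -/
theorem rescaleHom_id (a : A₀) : rescaleHom a (RingHom.id A₀[X]) = RingHom.id A₀[X] :=
  Polynomial.ringHom_ext (fun b => by rw [rescaleHom_C, RingHom.id_apply, sigmaScale_C])
    (by rw [rescaleHom_X, RingHom.id_apply])

/-- **Intertwining** (ours): if `Φ σ = σ` and `Φ` fixes `C a`, then `Φ_{aσ} ∘ (σ ↦ aσ) = (σ ↦ aσ) ∘ Φ`.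
[cite: SerreLocalFields1979, Ch. II §4 Lemma 1] -/
theorem rescaleHom_comp_sigmaScale (a : A₀) (Φ : A₀[X] →+* A₀[X]) (hX : Φ X = X) (ha : Φ (C a) = C a) :
    (rescaleHom a Φ).comp (sigmaScale a).toRingHom = (sigmaScale a).toRingHom.comp Φ := by
  refine Polynomial.ringHom_ext (fun b => ?_) ?_
  · rw [RingHom.comp_apply, RingHom.comp_apply, AlgHom.toRingHom_eq_coe, RingHom.coe_coe, sigmaScale_C, rescaleHom_C]
  · rw [RingHom.comp_apply, RingHom.comp_apply, AlgHom.toRingHom_eq_coe, RingHom.coe_coe, sigmaScale_X, map_mul, rescaleHom_C,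
      rescaleHom_X, ha, sigmaScale_C, hX, sigmaScale_X]

/-- … pointwise: `Φ_{aσ} ((σ ↦ aσ) f) = (σ ↦ aσ) (Φ f)` (plumbing). [cite: SerreLocalFields1979, Ch. II §4 Lemma 1] -/
theorem rescaleHom_sigmaScale_apply (a : A₀) (Φ : A₀[X] →+* A₀[X]) (hX : Φ X = X) (ha : Φ (C a) = C a) (f : A₀[X]) :
    rescaleHom a Φ (sigmaScale a f) = sigmaScale a (Φ f) := by
  have h := RingHom.congr_fun (rescaleHom_comp_sigmaScale a Φ hX ha) f
  rwa [RingHom.comp_apply, RingHom.comp_apply, AlgHom.toRingHom_eq_coe, RingHom.coe_coe] at h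

/-- **Composites rescale factorwise** (ours): `(Φ ∘ Ψ)_{aσ} = Φ_{aσ} ∘ Ψ_{aσ}` if `Φ σ = σ` and `Φ` fixes `C a`.
[cite: SerreLocalFields1979, Ch. II §4 Lemma 1] -/
theorem rescaleHom_comp (a : A₀) (Φ Ψ : A₀[X] →+* A₀[X]) (hX : Φ X = X) (ha : Φ (C a) = C a) :
    rescaleHom a (Φ.comp Ψ) = (rescaleHom a Φ).comp (rescaleHom a Ψ) := by
  refine Polynomial.ringHom_ext (fun b => ?_) ?_
  · rw [rescaleHom_C, RingHom.comp_apply, RingHom.comp_apply, rescaleHom_C, rescaleHom_sigmaScale_apply a Φ hX ha]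
  · rw [rescaleHom_X, RingHom.comp_apply, rescaleHom_X, rescaleHom_X]

/-- **Inverses rescale** (ours): `Φ ∘ Ψ = id`, `Φ σ = σ`, `Φ (C a) = C a` ⇒ `Φ_{aσ} ∘ Ψ_{aσ} = id`.
[cite: SerreLocalFields1979, Ch. II §4 Lemma 1] -/
theorem rescaleHom_comp_rescaleHom_eq_id (a : A₀) (Φ Ψ : A₀[X] →+* A₀[X]) (hX : Φ X = X) (ha : Φ (C a) = C a)
    (hΘ : Φ.comp Ψ = RingHom.id _) : (rescaleHom a Φ).comp (rescaleHom a Ψ) = RingHom.id _ := by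
  rw [← rescaleHom_comp a Φ Ψ hX ha, hΘ, rescaleHom_id]

/-- **`Φ_{aσ}` is again an isotropy** (ours; engine §1 (F2)): `Φ (C g) = C g ⇒ Φ_{aσ} (C g) = C g`, for every `a`.
[cite: SerreLocalFields1979, Ch. II §4 Lemma 1] -/
theorem isIsotropyOf_rescaleHom {g : A₀} {Φ : A₀[X] →+* A₀[X]} (hΦ : IsIsotropyOf g Φ) (a : A₀) :
    IsIsotropyOf g (rescaleHom a Φ) := by
  unfold IsIsotropyOf at hΦ ⊢
  rw [rescaleHom_C, hΦ, sigmaScale_C]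

/-- `Φ ≡ id (mod σ)` ⇒ `Φ_{aσ} ≡ id (mod σ)` (ours, bookkeeping). [cite: SerreLocalFields1979, Ch. II §4 Lemma 1] -/
theorem rescaleHom_sub_self_mem (a : A₀) (Φ : A₀[X] →+* A₀[X]) (hΦ : ∀ f, Φ f - f ∈ Ideal.span {(X : A₀[X])})
    (f : A₀[X]) : rescaleHom a Φ f - f ∈ Ideal.span {(X : A₀[X])} := by
  refine sub_self_mem_of_forall_C (rescaleHom a Φ) _ ?_ (fun b => ?_) f
  · rw [rescaleHom_X, sub_self]
    exact zero_mem _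
  · rw [rescaleHom_C, ← sub_add_sub_cancel _ (sigmaScale a (C b)) _, ← map_sub]
    exact add_mem (sigmaScale_mem_span_X a (hΦ _)) (by rw [sigmaScale_C, sub_self]; exact zero_mem _)

end SigmaScale

/-! ## Pure vectors of `Φ_{cσ}` -/

section Pure

variable {k : Type*} [CommRing k] {ι : Type*}

/-- The pure part commutes with `σ ↦ cσ` for a scalar `c` (bookkeeping). [cite: SerreLocalFields1979, Ch. II §4 Lemma 1] -/
theorem pureMap_sigmaScale (c : k) (f : (MvPolynomial ι k)[X]) :
    pureMap (sigmaScale (MvPolynomial.C c) f) = sigmaScale c (pureMap f) := by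
  rw [pureMap_apply, sigmaScale_apply, Polynomial.map_comp, Polynomial.map_mul, map_C, map_X, MvPolynomial.constantCoeff_C]
  rfl

/-- **`P(Φ_{cσ}) = P(Φ)(cσ)`** (ours; engine §7 (4)): the pure vector of the rescaled substitution is the rescaled pure vector.
[cite: SerreLocalFields1979, Ch. II §4 Lemma 1] -/
theorem pureVec_rescaleHom (c : k) (Φ : (MvPolynomial ι k)[X] →+* (MvPolynomial ι k)[X]) (i : ι) :
    pureVec (rescaleHom (MvPolynomial.C c) Φ) i = sigmaScale c (pureVec Φ i) := by
  rw [pureVec_apply, rescaleHom_C, pureMap_sigmaScale, pureVec_apply]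

/-- … coefficientwise: `P(Φ_{cσ})_{i,n} = c^n · P(Φ)_{i,n}` (ours). [cite: SerreLocalFields1979, Ch. II §4 Lemma 1] -/
theorem coeff_pureVec_rescaleHom (c : k) (Φ : (MvPolynomial ι k)[X] →+* (MvPolynomial ι k)[X]) (i : ι) (n : ℕ) :
    (pureVec (rescaleHom (MvPolynomial.C c) Φ) i).coeff n = c ^ n * (pureVec Φ i).coeff n := by
  rw [pureVec_rescaleHom, coeff_sigmaScale]

/-- A slot without pure entries stays without pure entries (ours). [cite: SerreLocalFields1979, Ch. II §4 Lemma 1] -/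
theorem pureVec_rescaleHom_eq_zero (c : k) {Φ : (MvPolynomial ι k)[X] →+* (MvPolynomial ι k)[X]} {i : ι}
    (h : pureVec Φ i = 0) : pureVec (rescaleHom (MvPolynomial.C c) Φ) i = 0 := by
  rw [pureVec_rescaleHom, h, map_zero]

/-- **Three rescalings** (ours; LEMMA FC (B3)): for scalars `l = (l₀, l₁, l₂)`,
`Σ_a P(Φ_{l_a σ})_{i,n} = (l₀^n + l₁^n + l₂^n) · P(Φ)_{i,n}` — with `l = (1, t(s), s)` over `R = k⟦s⟧` the factor is
`u_n = 1 + t^n + s^n` (`FermatComposition.powerSum l n`). [cite: SerreLocalFields1979, Ch. II §4 Lemma 1] -/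
theorem coeff_sum_pureVec_rescaleHom (l : Fin 3 → k) (Φ : (MvPolynomial ι k)[X] →+* (MvPolynomial ι k)[X]) (i : ι) (n : ℕ) :
    (∑ a, pureVec (rescaleHom (MvPolynomial.C (l a)) Φ) i).coeff n = (∑ a, l a ^ n) * (pureVec Φ i).coeff n := by
  rw [finsetSum_coeff, Finset.sum_mul]
  exact Finset.sum_congr rfl fun a _ => coeff_pureVec_rescaleHom (l a) Φ i n

/-- … so on an exponent `n` with `l₀^n + l₁^n + l₂^n = 0` (the cell: `n = j* = m p^e`, `u_{j*} = 0`) the three rescaled pure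
vectors cancel (ours; LEMMA FC (B3)). [cite: SerreLocalFields1979, Ch. II §4 Lemma 1] -/
theorem coeff_sum_pureVec_rescaleHom_eq_zero (l : Fin 3 → k) (Φ : (MvPolynomial ι k)[X] →+* (MvPolynomial ι k)[X]) (i : ι)
    {n : ℕ} (hn : ∑ a, l a ^ n = 0) : (∑ a, pureVec (rescaleHom (MvPolynomial.C (l a)) Φ) i).coeff n = 0 := by
  rw [coeff_sum_pureVec_rescaleHom, hn, zero_mul]

end Pure

/-! ## `Φ_{cσ}` is graded -/

section Graded

variable {k : Type*} [CommRing k] {ι : Type*} {M : Type*} [AddCommGroup M] {w : ι → M} {ρ : M}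

/-- `σ ↦ cσ` (`c` a scalar, weight `0`) preserves total-weight homogeneity (ours, bookkeeping).
[cite: AbramovichTemkinWlodarczyk2024, Thm. 5.3.1 (2)–(3) (p. 1578)] -/
theorem isTW_sigmaScale {n : M} {f : (MvPolynomial ι k)[X]} (hf : IsTW w ρ n f) (c : k) :
    IsTW w ρ n (sigmaScale (MvPolynomial.C c) f) := fun s => by
  rw [coeff_sigmaScale, ← map_pow]
  exact (hf s).C_mul _

/-- **`Φ` graded of degree `ρ` ⇒ `Φ_{cσ}` graded of degree `ρ`** for a scalar `c ∈ k` (ours; engine §1 (F2): `λ` of degree `0`).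
[cite: AbramovichTemkinWlodarczyk2024, Thm. 5.3.1 (2)–(3) (p. 1578)] -/
theorem isGradedHom_rescaleHom {Φ : (MvPolynomial ι k)[X] →+* (MvPolynomial ι k)[X]} (hΦ : IsGradedHom w ρ Φ) (c : k) :
    IsGradedHom w ρ (rescaleHom (MvPolynomial.C c) Φ) where
  map_C_C c' := by rw [rescaleHom_C, hΦ.map_C_C, sigmaScale_C]
  isTW_X := by rw [rescaleHom_X]; exact isTW_X
  isTW_CX i := by rw [rescaleHom_C]; exact isTW_sigmaScale (hΦ.isTW_CX i) c

end Graded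

end Literature.AlgebraicGeometry.Resolution.WeightedBlowup
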